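import Literature.NumberTheory.GaloisCohomology.Howard2004.DVRSettingEngineStub
import Literature.NumberTheory.GaloisCohomology.Howard2004.DVRSettingEngineKappa
import Literature.NumberTheory.GaloisCohomology.Howard2004.DVRSettingPiRefinementSelmer
import Literature.NumberTheory.GaloisCohomology.Howard2004.KolyvaginSystemReindex
import Literature.NumberTheory.GaloisCohomology.Howard2004.TowerMorphismPushforward
import HarnessLib

/-!
# Howard 2004, Lemma 1.6.4 on a `DVRSetting`: the reductions `red` between the level Selmer groups and the
compatibility `hred` of the Kolyvagin classes (ENGINE-RED / ENGINE-hred)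

B. Howard, *The Heegner point Kolyvagin system*, Compos. Math. 140 (2004) 1439–1472, §1.6 (arXiv:1202.6340
§2.6), proof of Lemma 1.6.4 (arXiv p. 11 L82 – p. 12 L27): «… `κ^{(i)}_n` is the reduction of `κ^{(k)}_n` …»
(the classes of a Kolyvagin system for `(T, F, 𝓛)` are compatible under the reductions `T^{(k)} ↠ T^{(i)}`,
Def. 1.2.3), used in the first case of the proof («if `κ^{(λ)}(n) = 0` then by liftability …»).

This file supplies, for the engine `DVRSettingEngineData.mem_stub_of_stubLemmaInduction_levels'` instantiated on
a `DVRSetting` (`H k n = ↥(S.selmerModuleAt hy k n)`), the DATA `red k i n` and the HYPOTHESIS `hred`: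

* §1 (generic) `SelmerTriple.cohomologyMap_mem_selmerGroup_atLevel`: `H¹(f)` carries `H¹_{F(n)}(K, T)` into
  `H¹_{F′(n)}(K, T′)` as soon as `H¹_v(f)(F_v) ⊆ F′_v` at every place (the transverse slots at `λ ∈ n` are
  functorial in the module).
* §2 `DVRSetting.redLEH1 (h : i ≤ k)` = `H¹(K, T^{(k)} ↠ T^{(i)})`; it maps `H¹_{F(n)}(K, T^{(k)})` into
  `H¹_{F(n)}(K, T^{(i)})` (`cond_redLE`) and is `R`-linear; the restriction
  `DVRSetting.redSelLE hy h n : ↥(S.selmerModuleAt hy k n) →ₗ[R] ↥(S.selmerModuleAt hy i n)` and the engine's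
  total letter `DVRSetting.redSel hy k i n` (`0` for `i > k`).
* §3 the Kolyvagin class as a TOTAL family `DVRSetting.kappaSel hy κ pins k n : ↥(S.selmerModuleAt hy k n)`
  (`kappaR` is an `F(n)`-Selmer class unconditionally: off its defining branch it is `0`).
* §4 **`redSel_kappaSel`** — the engine's `hred`, GUARDED by `↑n ⊆ 𝓛^{(2k-1)}`:
  `red k i n (κ k n) = κ i n` for `i ≤ k` and `n ∈ 𝓝(𝓛^{(2k-1)})`; from `κ_red` iterated
  (`CoeffTowerSetting.KolyvaginSystem.κ_redIter`), the square `rqIter ∘ π^{(k)}_n = π^{(i)}_n ∘ redIter`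
  (`rqIter_comp`) and the uniqueness of the de-tensored class (`eq_kappaR_of_tmul_eq`).
* §5 the engine with the GUARDED `hred` (`mem_stub_of_stubLemmaInduction_levels_guarded`): the induction of
  `mem_stub_of_stubLemmaInduction_levels'` only ever uses `hred` at `n ∈ 𝓝(P k)`.

Definitions with bodies and theorems: no named fact, no instance, no notation, no `sorry`.
`thm161_dvrKolyvaginBound` is NOT proved; BSD is not proved by any of this.
-/

set_option autoImplicit false

noncomputable section

open Function NumberField IsDedekindDomain Field
open scoped NumberField ContRepresentation Classical TensorProduct

namespace Literature.NumberTheory.GaloisCohomology.Howard2004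

open Literature.NumberTheory.GaloisRepresentations
open Literature.NumberTheory.GaloisRepresentations.DiscreteGaloisModule
open Literature.NumberTheory.GaloisRepresentations.galoisCohomology

/-! ## §1 `H¹(f)` on the level Selmer groups `H¹_{F(n)}` -/

namespace SelmerTriple

variable {p : ℕ} [Fact p.Prime] {K : Type} [Field K] [NumberField K]
  {M₁ : Type} [AddCommGroup M₁] [TopologicalSpace M₁] [DiscreteTopology M₁]
  {M₂ : Type} [AddCommGroup M₂] [TopologicalSpace M₂] [DiscreteTopology M₂]

/-- **`H¹(f)` carries `H¹_{F(n)}(K, T)` into `H¹_{F′(n)}(K, T′)`** for an equivariant additive `f : T → T′` with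
`H¹_v(f)(F_v) ⊆ F′_v` at every place `v`: at `v ∉ n` by this hypothesis, at `λ ∈ n` because the transverse
condition is functorial in the module. [cite: Howard2004HeegnerKolyvagin, Def. 1.2.2 and Rem. 1.2.4 (ii) (arXiv p. 6 L101 – p. 7 L20)] -/
theorem cohomologyMap_mem_selmerGroup_atLevel (τ₁ : DiscreteGaloisModule K M₁) (τ₂ : DiscreteGaloisModule K M₂)
    (t : SelmerTriple p τ₁) (t' : SelmerTriple p τ₂) (f : M₁ →+ M₂)
    (hf : ∀ (g : absoluteGaloisGroup K) (x : M₁), f (τ₁ g x) = τ₂ g (f x))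
    (hcond : ∀ v : Place K, ((t.cond v).map
      (ContinuousRep.cohomologyMap (τ₁.toLocal v) (τ₂.toLocal v) f continuous_of_discreteTopology
        (fun _ y => hf _ y) 1)) ≤ t'.cond v)
    (jbar : AlgebraicClosure K →+* ℂ) {n : Finset (HeightOneSpectrum (𝓞 K))} {c : galoisCohomology τ₁ 1}
    (hc : c ∈ ((t.atLevel jbar n).cond).selmerGroup) :
    ContinuousRep.cohomologyMap τ₁ τ₂ f continuous_of_discreteTopology hf 1 c ∈
      ((t'.atLevel jbar n).cond).selmerGroup := by
  rw [SelmerStructure.mem_selmerGroup_iff] at hc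
  refine (SelmerStructure.mem_selmerGroup_iff _ _).mpr fun w => ?_
  have hu := hc w
  show galoisCohomology.localization τ₂ w 1
      (ContinuousRep.cohomologyMap τ₁ τ₂ f continuous_of_discreteTopology hf 1 c) ∈ (t'.atLevel jbar n).cond w
  rw [localization_cohomologyMap_one]
  rcases w with w | v
  · exact hcond _ ⟨_, hu, rfl⟩
  · by_cases hv : v ∈ n
    · rw [SelmerTriple.atLevel_cond_inr_of_mem t jbar hv] at hu
      rw [SelmerTriple.atLevel_cond_inr_of_mem t' jbar hv]
      exact cohomologyMap_mem_transverseCondition τ₁ τ₂ f hf _ jbar v hu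
    · rw [SelmerTriple.atLevel_cond_inr_of_not_mem t jbar hv] at hu
      rw [SelmerTriple.atLevel_cond_inr_of_not_mem t' jbar hv]
      exact hcond _ ⟨_, hu, rfl⟩

end SelmerTriple

/-! ## §5 The engine with the GUARDED compatibility hypothesis `hred` -/

section Levels

variable {R : Type*} [CommRing R] {ι : Type*} [DecidableEq ι]
  {H : ℕ → Finset ι → Type*} [∀ k n, AddCommGroup (H k n)] [∀ k n, Module R (H k n)]
  {L : ℕ → Finset ι → ι → Type*} [∀ k n ℓ, AddCommGroup (L k n ℓ)] [∀ k n ℓ, Module R (L k n ℓ)]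
  (P : ℕ → Set ι) (ϖ : R) (κ : ∀ k n, H k n) (Stub : ∀ k n, Submodule R (H k n))
  (lam : ℕ → Finset ι → ℕ) (ρp ρm : ℕ → Finset ι → ℕ) (loc : ∀ k n ℓ, H k n →ₗ[R] L k n ℓ)
  (red : ∀ k i n, H k n →ₗ[R] H i n)

omit [DecidableEq ι] in
/-- `mem_stub_of_ne_bot_of_lower_levels'` with `hred` only required for `n ∈ 𝓝(P k)` (the only sets at which the
induction reads it). [cite: Howard2004HeegnerKolyvagin, Lemma 1.6.4 proof, first case (arXiv p. 11 L85 – p. 12 L1)] -/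
theorem mem_stub_of_ne_bot_of_lower_levels_guarded
    (hP : ∀ i k, i ≤ k → P k ⊆ P i)
    (hlam : ∀ k n, ↑n ⊆ P k → Stub k n ≠ ⊥ → Stub k n = ⊤ ∨ (lam k n < k ∧ Stub (lam k n) n = ⊥))
    (hred : ∀ k i n, i ≤ k → ↑n ⊆ P k → red k i n (κ k n) = κ i n)
    (hlift : ∀ k n, ↑n ⊆ P k → Stub k n ≠ ⊥ → Stub k n ≠ ⊤ → red k (lam k n) n (κ k n) = 0 → κ k n ∈ Stub k n)
    (k : ℕ) (ih : ∀ i, i < k → ∀ n, ↑n ⊆ P i → κ i n ∈ Stub i n)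
    (n : Finset ι) (hn : ↑n ⊆ P k) (hst : Stub k n ≠ ⊥) : κ k n ∈ Stub k n := by
  rcases hlam k n hn hst with htop | ⟨hi, hbot⟩
  · rw [htop]; exact Submodule.mem_top
  · have hmem : κ (lam k n) n ∈ Stub (lam k n) n := ih _ hi n (fun x hx => hP _ _ hi.le (hn hx))
    rw [hbot, Submodule.mem_bot] at hmem
    by_cases htop : Stub k n = ⊤
    · rw [htop]; exact Submodule.mem_top
    refine hlift k n hn hst htop ?_
    rw [hred k (lam k n) n hi.le hn, hmem]

/-- **The engine's all-levels theorem** `mem_stub_of_stubLemmaInduction_levels'` **with the GUARDED `hred`**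
(`∀ k i n, i ≤ k → ↑n ⊆ P k → red k i n (κ k n) = κ i n`, which is what a Kolyvagin system supplies, §4):
`κ^{(k)}_n ∈ Stub^{(k)}(n)` for every level `k` and every `n ∈ 𝓝(P k)`.
[cite: Howard2004HeegnerKolyvagin, Lemma 1.6.4 (arXiv Lemma 2.6.4, p. 11 L82 – p. 12 L27)] -/
theorem mem_stub_of_stubLemmaInduction_levels_guarded
    (hP : ∀ i k, i ≤ k → P k ⊆ P i)
    (hlam : ∀ k n, ↑n ⊆ P k → Stub k n ≠ ⊥ → Stub k n = ⊤ ∨ (lam k n < k ∧ Stub (lam k n) n = ⊥))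
    (hred : ∀ k i n, i ≤ k → ↑n ⊆ P k → red k i n (κ k n) = κ i n)
    (hlift : ∀ k n, ↑n ⊆ P k → Stub k n ≠ ⊥ → Stub k n ≠ ⊤ → red k (lam k n) n (κ k n) = 0 → κ k n ∈ Stub k n)
    (hKS : ∀ k n (ℓ : ι), ↑n ⊆ P k → ℓ ∈ P k → ℓ ∉ n →
      (loc k n ℓ (κ k n) = 0 ↔ loc k (insert ℓ n) ℓ (κ k (insert ℓ n)) = 0))
    (h159 : ∀ k n (ℓ : ι), ↑n ⊆ P k → ℓ ∈ P k → ℓ ∉ n →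
      Stub k n ≤ LinearMap.ker (loc k n ℓ) →
        Stub k (insert ℓ n) ≤ LinearMap.ker (loc k (insert ℓ n) ℓ))
    (hsmall : ∀ k n, ↑n ⊆ P k → ρp k n + ρm k n ≤ 1 → Stub k n = ⊤)
    (htors : ∀ k n (x : H k n), ∃ j : ℕ, ϖ ^ j • x = 0)
    (hchebI : ∀ k n, ↑n ⊆ P k → 0 < ρp k n → 0 < ρm k n → ∀ d : H k n, d ≠ 0 → ϖ • d = 0 →
      ∃ ℓ ∈ P k, ℓ ∉ n ∧ loc k n ℓ d ≠ 0 ∧ ρp k (insert ℓ n) + 1 = ρp k n ∧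
        ρm k (insert ℓ n) + 1 = ρm k n)
    (hchebII : ∀ k n, ↑n ⊆ P k → (ρm k n = 0 ∧ 2 ≤ ρp k n) ∨ (ρp k n = 0 ∧ 2 ≤ ρm k n) →
      ∀ d : H k n, d ≠ 0 → ϖ • d = 0 →
      ∃ ℓ ∈ P k, ℓ ∉ n ∧ loc k n ℓ d ≠ 0 ∧ 0 < ρp k (insert ℓ n) ∧ 0 < ρm k (insert ℓ n) ∧
        ρp k (insert ℓ n) + ρm k (insert ℓ n) = ρp k n + ρm k n)
    (k : ℕ) (n : Finset ι) (hn : ↑n ⊆ P k) : κ k n ∈ Stub k n := by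
  induction k using Nat.strong_induction_on generalizing n with
  | _ k ih =>
    exact mem_stub_of_stubLemmaInduction (P k) ϖ (κ k) (Stub k) (ρp k) (ρm k) (loc k) (hKS k)
      (h159 k) (hsmall k)
      (mem_stub_of_ne_bot_of_lower_levels_guarded P κ Stub lam red hP hlam hred hlift k ih)
      (htors k) (hchebI k) (hchebII k) n hn

end Levels

/-! ## §2–§4 The reductions and the Kolyvagin classes on a `DVRSetting` -/

namespace DVRSetting

variable {p : ℕ} [Fact p.Prime] {K : Type} [Field K] [NumberField K]
  {R : Type} [CommRing R] [IsDomain R] [IsDiscreteValuationRing R] [Algebra ℤ_[p] R]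
  {N : ℕ → Type} [∀ k, AddCommGroup (N k)] [∀ k, TopologicalSpace (N k)]
  [∀ k, DiscreteTopology (N k)] [∀ k, Module R (N k)]
  {Rk : ℕ → Type} [∀ k, CommRing (Rk k)] [∀ k, IsLocalRing (Rk k)] [∀ k, TopologicalSpace (Rk k)]
  [∀ k, DiscreteTopology (Rk k)] [∀ k, Algebra ℤ_[p] (Rk k)] [∀ k, Algebra R (Rk k)]
  [∀ k, Module (Rk k) (N k)] [∀ k, IsScalarTower R (Rk k) (N k)]
  {Nbar : Type} [AddCommGroup Nbar] [TopologicalSpace Nbar] [DiscreteTopology Nbar]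
  [∀ k, Module (Rk k) Nbar]
  {Nq : ℕ → Finset (HeightOneSpectrum (𝓞 K)) → Type} [∀ k n, AddCommGroup (Nq k n)]
  [∀ k n, TopologicalSpace (Nq k n)] [∀ k n, DiscreteTopology (Nq k n)]
  [∀ k n, Module (Rk k) (Nq k n)] [∀ k n, Module R (Nq k n)]
  [∀ k n, IsScalarTower R (Rk k) (Nq k n)]

/-! ### §2 `red`: `H¹` of the reductions `T^{(k)} ↠ T^{(i)}` on the level Selmer groups -/

/-- **`H¹(K, T^{(k)}) → H¹(K, T^{(i)})` induced by the reduction `T^{(k)} ↠ T^{(i)}`** (`i ≤ k`, tree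
`AdicTower.redLE`). [cite: Howard2004HeegnerKolyvagin, §1.6 and Lemma 1.6.4 (arXiv p. 11 L33–38, L85–90)] -/
def redLEH1 (S : DVRSetting p K R N Rk Nbar Nq) {i k : ℕ} (h : i ≤ k) :
    galoisCohomology (S.T.ρ k) 1 →+ galoisCohomology (S.T.ρ i) 1 :=
  ContinuousRep.cohomologyMap (S.T.ρ k) (S.T.ρ i) (S.T.redLE h).toAddMonoidHom continuous_of_discreteTopology
    (fun _ x => S.T.redLE_equivariant h _ x) 1

/-- Unfolding `redLEH1`. [cite: Howard2004HeegnerKolyvagin, §1.6 (arXiv p. 11 L33–38)] -/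
theorem redLEH1_apply (S : DVRSetting p K R N Rk Nbar Nq) {i k : ℕ} (h : i ≤ k) (c : galoisCohomology (S.T.ρ k) 1) :
    S.redLEH1 h c = ContinuousRep.cohomologyMap (S.T.ρ k) (S.T.ρ i) (S.T.redLE h).toAddMonoidHom
      continuous_of_discreteTopology (fun _ x => S.T.redLE_equivariant h _ x) 1 c := rfl

/-- `redLEH1 (le_refl k) = id`. [cite: Howard2004HeegnerKolyvagin, §1.6 (arXiv p. 11 L33–38)] -/
theorem redLEH1_self (S : DVRSetting p K R N Rk Nbar Nq) (k : ℕ) (c : galoisCohomology (S.T.ρ k) 1) :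
    S.redLEH1 (le_refl k) c = c :=
  cohomologyMap_one_id_apply (S.T.ρ k) (S.T.redLE (le_refl k)).toAddMonoidHom
    (fun _ x => S.T.redLE_equivariant (le_refl k) _ x) (fun x => S.T.redLE_self k x) c

/-- `redLEH1 (i ≤ i + d)` is the iterated reduction `redIterH1 i d`. [cite: Howard2004HeegnerKolyvagin, §1.6 (arXiv p. 12, L29–33)] -/
theorem redLEH1_eq_redIterH1 (S : DVRSetting p K R N Rk Nbar Nq) (i d : ℕ) (h : i ≤ i + d)
    (c : galoisCohomology (S.T.ρ (i + d)) 1) : S.redLEH1 h c = S.T.redIterH1 i d c :=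
  cohomologyMap_one_congr_apply (S.T.ρ (i + d)) (S.T.ρ i) (S.T.redLE h).toAddMonoidHom
    (S.T.redIter i d).toAddMonoidHom (fun _ x => S.T.redLE_equivariant h _ x) (S.T.redIter_equivariant i d)
    (fun x => AdicTower.redLE_eq_redIter S.T i d x) c

/-- Localisation commutes with `redLEH1`: `loc_v ∘ H¹(redLE) = H¹_v(redLE) ∘ loc_v`.
[cite: Howard2004HeegnerKolyvagin, §1.6 (arXiv p. 12, L5–9)] -/
theorem localization_redLEH1 (S : DVRSetting p K R N Rk Nbar Nq) {i k : ℕ} (h : i ≤ k) (v : Place K)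
    (c : galoisCohomology (S.T.ρ k) 1) :
    galoisCohomology.localization (S.T.ρ i) v 1 (S.redLEH1 h c) =
      S.redLELoc h v (galoisCohomology.localization (S.T.ρ k) v 1 c) :=
  localization_cohomologyMap_one (S.T.ρ k) (S.T.ρ i) (S.T.redLE h).toAddMonoidHom
    (fun _ x => S.T.redLE_equivariant h _ x) v c

/-- **`H¹(redLE)` maps `H¹_{F(n)}(K, T^{(k)})` into `H¹_{F(n)}(K, T^{(i)})`**: the conditions `F` reduce onto
each other (`cond_redLE`) and the transverse slots are functorial (§1).
[cite: Howard2004HeegnerKolyvagin, §1.6 and Lemma 1.6.4 (arXiv p. 11 L33–38, p. 12 L1–9)] -/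
theorem redLEH1_mem_selmerGroup_atLevel (S : DVRSetting p K R N Rk Nbar Nq) (hy : S.SatisfiesH) {i k : ℕ}
    (h : i ≤ k) (n : Finset (HeightOneSpectrum (𝓞 K))) {c : galoisCohomology (S.T.ρ k) 1}
    (hc : c ∈ (((S.t k).atLevel S.jbar n).cond).selmerGroup) :
    S.redLEH1 h c ∈ (((S.t i).atLevel S.jbar n).cond).selmerGroup :=
  SelmerTriple.cohomologyMap_mem_selmerGroup_atLevel (S.T.ρ k) (S.T.ρ i) (S.t k) (S.t i)
    (S.T.redLE h).toAddMonoidHom (fun _ x => S.T.redLE_equivariant h _ x)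
    (fun v => (S.cond_redLE hy h v).le) S.jbar hc

/-- **`H¹(redLE)` is `R`-linear** for the functorial scalar actions (`scalarMapH1`).
[cite: Howard2004HeegnerKolyvagin, §1.1 and §1.6 (arXiv p. 5 L20–21, p. 11 L33–38)] -/
theorem redLEH1_scalarMapH1 (S : DVRSetting p K R N Rk Nbar Nq) {i k : ℕ} (h : i ≤ k) (r : R)
    (c : galoisCohomology (S.T.ρ k) 1) :
    S.redLEH1 h (scalarMapH1 (S.T.ρ k) (S.T.hlin k) r c) = scalarMapH1 (S.T.ρ i) (S.T.hlin i) r (S.redLEH1 h c) :=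
  cohomologyMap_scalarMapH1 (S.T.hlin k) (S.T.hlin i) (S.T.redLE h) (S.T.redLE_equivariant h) r c

/-- **`red` for `i ≤ k`: `H¹(redLE)` restricted to the level Selmer groups, as an `R`-linear map
`H¹_{F(n)}(K, T^{(k)}) →ₗ[R] H¹_{F(n)}(K, T^{(i)})`.** [cite: Howard2004HeegnerKolyvagin, Lemma 1.6.4 (arXiv p. 11 L85 – p. 12 L9)] -/
def redSelLE (S : DVRSetting p K R N Rk Nbar Nq) (hy : S.SatisfiesH) {i k : ℕ} (h : i ≤ k)
    (n : Finset (HeightOneSpectrum (𝓞 K))) :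
    letI := galoisCohomology.moduleH1 (S.T.ρ k) (S.T.hlin k)
    letI := galoisCohomology.moduleH1 (S.T.ρ i) (S.T.hlin i)
    ↥(S.selmerModuleAt hy k n) →ₗ[R] ↥(S.selmerModuleAt hy i n) :=
  letI := galoisCohomology.moduleH1 (S.T.ρ k) (S.T.hlin k)
  letI := galoisCohomology.moduleH1 (S.T.ρ i) (S.T.hlin i)
  { toFun := fun x => ⟨S.redLEH1 h x, S.redLEH1_mem_selmerGroup_atLevel hy h n x.2⟩
    map_add' := fun x y => Subtype.ext (map_add (S.redLEH1 h) x.1 y.1)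
    map_smul' := fun r x => Subtype.ext (S.redLEH1_scalarMapH1 h r x) }

/-- Unfolding `redSelLE` on classes. [cite: Howard2004HeegnerKolyvagin, Lemma 1.6.4 (arXiv p. 11 L85–90)] -/
@[simp] theorem coe_redSelLE_apply (S : DVRSetting p K R N Rk Nbar Nq) (hy : S.SatisfiesH) {i k : ℕ} (h : i ≤ k)
    (n : Finset (HeightOneSpectrum (𝓞 K))) (x : ↥(S.selmerModuleAt hy k n)) :
    letI := galoisCohomology.moduleH1 (S.T.ρ k) (S.T.hlin k)
    letI := galoisCohomology.moduleH1 (S.T.ρ i) (S.T.hlin i)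
    ((S.redSelLE hy h n x : ↥(S.selmerModuleAt hy i n)) : galoisCohomology (S.T.ρ i) 1) = S.redLEH1 h x := rfl

/-- **The engine's letter `red k i n : H k n →ₗ[R] H i n`** (total in `(k, i)`): `redSelLE` for `i ≤ k`, the junk
value `0` for `i > k`. [cite: Howard2004HeegnerKolyvagin, Lemma 1.6.4 (arXiv p. 11 L85 – p. 12 L9)] -/
def redSel (S : DVRSetting p K R N Rk Nbar Nq) (hy : S.SatisfiesH) (k i : ℕ)
    (n : Finset (HeightOneSpectrum (𝓞 K))) :
    letI := galoisCohomology.moduleH1 (S.T.ρ k) (S.T.hlin k)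
    letI := galoisCohomology.moduleH1 (S.T.ρ i) (S.T.hlin i)
    ↥(S.selmerModuleAt hy k n) →ₗ[R] ↥(S.selmerModuleAt hy i n) :=
  letI := galoisCohomology.moduleH1 (S.T.ρ k) (S.T.hlin k)
  letI := galoisCohomology.moduleH1 (S.T.ρ i) (S.T.hlin i)
  if h : i ≤ k then S.redSelLE hy h n else 0

/-- `redSel k i n = redSelLE h n` for `h : i ≤ k`. [cite: Howard2004HeegnerKolyvagin, Lemma 1.6.4 (arXiv p. 11 L85–90)] -/
theorem redSel_of_le (S : DVRSetting p K R N Rk Nbar Nq) (hy : S.SatisfiesH) {k i : ℕ} (h : i ≤ k)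
    (n : Finset (HeightOneSpectrum (𝓞 K))) :
    letI := galoisCohomology.moduleH1 (S.T.ρ k) (S.T.hlin k)
    letI := galoisCohomology.moduleH1 (S.T.ρ i) (S.T.hlin i)
    S.redSel hy k i n = S.redSelLE hy h n := by
  letI := galoisCohomology.moduleH1 (S.T.ρ k) (S.T.hlin k)
  letI := galoisCohomology.moduleH1 (S.T.ρ i) (S.T.hlin i)
  exact dif_pos h

/-- `redSel k i n = 0` for `k < i` (junk). [cite: Howard2004HeegnerKolyvagin, Lemma 1.6.4 (arXiv p. 11 L85–90)] -/
theorem redSel_of_lt (S : DVRSetting p K R N Rk Nbar Nq) (hy : S.SatisfiesH) {k i : ℕ} (h : k < i)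
    (n : Finset (HeightOneSpectrum (𝓞 K))) :
    letI := galoisCohomology.moduleH1 (S.T.ρ k) (S.T.hlin k)
    letI := galoisCohomology.moduleH1 (S.T.ρ i) (S.T.hlin i)
    S.redSel hy k i n = 0 := by
  letI := galoisCohomology.moduleH1 (S.T.ρ k) (S.T.hlin k)
  letI := galoisCohomology.moduleH1 (S.T.ρ i) (S.T.hlin i)
  exact dif_neg (Nat.not_le.mpr h)

/-- **`red k i n` on classes**: for `i ≤ k` it is `H¹(redLE)`. [cite: Howard2004HeegnerKolyvagin, Lemma 1.6.4 (arXiv p. 11 L85 – p. 12 L9)] -/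
theorem coe_redSel_apply (S : DVRSetting p K R N Rk Nbar Nq) (hy : S.SatisfiesH) {k i : ℕ} (h : i ≤ k)
    (n : Finset (HeightOneSpectrum (𝓞 K))) (x : ↥(S.selmerModuleAt hy k n)) :
    letI := galoisCohomology.moduleH1 (S.T.ρ k) (S.T.hlin k)
    letI := galoisCohomology.moduleH1 (S.T.ρ i) (S.T.hlin i)
    ((S.redSel hy k i n x : ↥(S.selmerModuleAt hy i n)) : galoisCohomology (S.T.ρ i) 1) = S.redLEH1 h x := by
  letI := galoisCohomology.moduleH1 (S.T.ρ k) (S.T.hlin k)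
  letI := galoisCohomology.moduleH1 (S.T.ρ i) (S.T.hlin i)
  rw [S.redSel_of_le hy h n]
  rfl

/-! ### §3 The Kolyvagin classes as a total family in the level Selmer groups -/

/-- **`κ k n` is an `F(n)`-Selmer class of `T^{(k)}`, unconditionally** (off the defining branch `kappaR = 0`).
[cite: Howard2004HeegnerKolyvagin, Def. 1.2.3 and Lemma 1.6.4 (arXiv p. 7 L1–12, p. 11 L88–90)] -/
theorem kappaR_mem_selmerGroup_atLevel (S : DVRSetting p K R N Rk Nbar Nq) (κ : S.KolyvaginSystem)
    (pins : ∀ v : HeightOneSpectrum (𝓞 K), TamePin v) (k : ℕ) (n : Finset (HeightOneSpectrum (𝓞 K))) :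
    S.kappaR κ pins k n ∈ (((S.t k).atLevel S.jbar n).cond).selmerGroup := by
  by_cases h : LinearMap.ker ((S.LD k).π n) = ⊥ ∧ n ∈ (S.t k).levelSet
  · exact S.kappaR_mem_selmerGroup κ pins k h.1 h.2
  · rw [kappaR, dif_neg h]
    exact AddSubgroup.zero_mem _

/-- **The engine's letter `κ k n : H k n`** — the Kolyvagin class `κ^{(k)}_n` read in `H¹_{F(n)}(K, T^{(k)})`
(`kappaR`), as a TOTAL family of elements of the `R`-modules `selmerModuleAt`.
[cite: Howard2004HeegnerKolyvagin, Def. 1.2.3 and Lemma 1.6.4 (arXiv p. 7 L1–12, p. 11 L88–90)] -/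
def kappaSel (S : DVRSetting p K R N Rk Nbar Nq) (hy : S.SatisfiesH) (κ : S.KolyvaginSystem)
    (pins : ∀ v : HeightOneSpectrum (𝓞 K), TamePin v) (k : ℕ) (n : Finset (HeightOneSpectrum (𝓞 K))) :
    ↥(S.selmerModuleAt hy k n) :=
  ⟨S.kappaR κ pins k n, S.kappaR_mem_selmerGroup_atLevel κ pins k n⟩

/-- Unfolding `kappaSel`. [cite: Howard2004HeegnerKolyvagin, Def. 1.2.3 (arXiv p. 7 L1–12)] -/
@[simp] theorem coe_kappaSel (S : DVRSetting p K R N Rk Nbar Nq) (hy : S.SatisfiesH) (κ : S.KolyvaginSystem)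
    (pins : ∀ v : HeightOneSpectrum (𝓞 K), TamePin v) (k : ℕ) (n : Finset (HeightOneSpectrum (𝓞 K))) :
    (S.kappaSel hy κ pins k n : galoisCohomology (S.T.ρ k) 1) = S.kappaR κ pins k n := rfl

/-- `κ k n = 0 ↔ kappaR k n = 0`. [cite: Howard2004HeegnerKolyvagin, Lemma 1.6.4 proof (arXiv p. 12 L2)] -/
theorem kappaSel_eq_zero_iff (S : DVRSetting p K R N Rk Nbar Nq) (hy : S.SatisfiesH) (κ : S.KolyvaginSystem)
    (pins : ∀ v : HeightOneSpectrum (𝓞 K), TamePin v) (k : ℕ) (n : Finset (HeightOneSpectrum (𝓞 K))) :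
    S.kappaSel hy κ pins k n = 0 ↔ S.kappaR κ pins k n = 0 := by
  rw [← coe_kappaSel S hy κ pins k n]
  exact ⟨fun h => by rw [h]; rfl, fun h => Subtype.ext h⟩

/-! ### §4 `hred`: the classes are compatible under the reductions -/

/-- **`H¹(redIter_{i,d})(κ (i+d) n) = κ i n` for `n ∈ 𝓝(𝓛^{(2(i+d)-1)})`**: `κ_red` iterated on
`H¹(K, T/I_n) ⊗ G_n` (`κ_redIter`), transported through the presentations by the square
`rqIter ∘ π^{(i+d)}_n = π^{(i)}_n ∘ redIter` and de-tensored by the uniqueness of `kappaR`.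
[cite: Howard2004HeegnerKolyvagin, Def. 1.2.3 and Lemma 1.6.4 proof (arXiv p. 7 L1–12, p. 11 L85 – p. 12 L1)] -/
theorem redIterH1_kappaR (S : DVRSetting p K R N Rk Nbar Nq) (hy : S.SatisfiesH) (κ : S.KolyvaginSystem)
    (pins : ∀ v : HeightOneSpectrum (𝓞 K), TamePin v) (i d : ℕ) {n : Finset (HeightOneSpectrum (𝓞 K))}
    (hn : ↑n ⊆ S.enginePrimes (i + d)) :
    S.T.redIterH1 i d (S.kappaR κ pins (i + d) n) = S.kappaR κ pins i n := by
  have hni : ↑n ⊆ S.enginePrimes i := fun v hv => S.enginePrimes_antitone hy (Nat.le_add_right i d) (hn hv)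
  have hker' := S.ker_π_eq_bot_of_subset_enginePrimes hy (i + d) hn
  have hker := S.ker_π_eq_bot_of_subset_enginePrimes hy i hni
  have hlev' : n ∈ (S.t (i + d)).levelSet := S.mem_levelSet_of_subset_enginePrimes hy (i + d) (i + d) hn
  have hlev : n ∈ (S.t i).levelSet := S.mem_levelSet_of_subset_enginePrimes hy (i + d) i hn
  -- the square `rqIter ∘ π^{(i+d)}_n = π^{(i)}_n ∘ redIter` on `H¹`
  have hsq : ∀ a : galoisCohomology (S.T.ρ (i + d)) 1,
      S.toCoeffTowerSetting.rqIterH1 i n d (((S.LD (i + d)).isQuotientBy n).cohomologyMap 1 a) =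
        ((S.LD i).isQuotientBy n).cohomologyMap 1 (S.T.redIterH1 i d a) := fun a =>
    cohomologyMap_one_comm_sq (S.T.ρ (i + d)) ((S.LD (i + d)).ρq n) (S.T.ρ i) ((S.LD i).ρq n)
      ((S.LD (i + d)).π n).toAddMonoidHom ((S.LD (i + d)).isQuotientBy n).equivariant
      (S.toCoeffTowerSetting.rqIter i n d).toAddMonoidHom (S.toCoeffTowerSetting.rqIter_equivariant i n d)
      (S.T.redIter i d).toAddMonoidHom (S.T.redIter_equivariant i d)
      ((S.LD i).π n).toAddMonoidHom ((S.LD i).isQuotientBy n).equivariant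
      (fun x => S.toCoeffTowerSetting.rqIter_comp i n d x) a
  -- `(rqIterH1 ∘ subtype) ⊗ 1 = (rqIterH1 ⊗ 1) ∘ (subtype ⊗ 1)`
  have hB : TensorProduct.map ((S.toCoeffTowerSetting.rqIterH1 i n d).comp
        ((S.toCoeffTowerSetting.LD (i + d)).selmerAt S.toCoeffTowerSetting.jbar n).subtype).toIntLinearMap
        (LinearMap.id : Gn (K := K) n →ₗ[ℤ] Gn (K := K) n) =
      TensorProduct.map (S.toCoeffTowerSetting.rqIterH1 i n d).toIntLinearMap LinearMap.id ∘ₗ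
        TensorProduct.map ((S.toCoeffTowerSetting.LD (i + d)).selmerAt S.toCoeffTowerSetting.jbar n
          ).subtype.toIntLinearMap (LinearMap.id : Gn (K := K) n →ₗ[ℤ] Gn (K := K) n) := by
    rw [← TensorProduct.map_comp, LinearMap.comp_id]
    rfl
  -- `κ_red` iterated (`κ_redIter`), the defining identity of `kappaR` at level `i + d`, and the square
  have h2 : TensorProduct.map ((S.LD i).selmerAt S.jbar n).subtype.toIntLinearMap LinearMap.id (κ.κ i n) =
      ((S.LD i).isQuotientBy n).cohomologyMap 1 (S.T.redIterH1 i d (S.kappaR κ pins (i + d) n)) ⊗ₜ[ℤ]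
        (PiTensorProduct.tprod ℤ fun q : ↥n => (pins q).gbar : Gn (K := K) n) :=
    calc TensorProduct.map ((S.LD i).selmerAt S.jbar n).subtype.toIntLinearMap LinearMap.id (κ.κ i n)
        = TensorProduct.map ((S.toCoeffTowerSetting.rqIterH1 i n d).comp
            ((S.toCoeffTowerSetting.LD (i + d)).selmerAt S.toCoeffTowerSetting.jbar n).subtype).toIntLinearMap
            (LinearMap.id : Gn (K := K) n →ₗ[ℤ] Gn (K := K) n) ((KolyvaginSystem.toCoeff κ).κ (i + d) n) :=
          (CoeffTowerSetting.KolyvaginSystem.κ_redIter (KolyvaginSystem.toCoeff κ) i n d).symm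
      _ = TensorProduct.map (S.toCoeffTowerSetting.rqIterH1 i n d).toIntLinearMap LinearMap.id
            (TensorProduct.map ((S.toCoeffTowerSetting.LD (i + d)).selmerAt S.toCoeffTowerSetting.jbar n
              ).subtype.toIntLinearMap (LinearMap.id : Gn (K := K) n →ₗ[ℤ] Gn (K := K) n)
              ((KolyvaginSystem.toCoeff κ).κ (i + d) n)) := LinearMap.congr_fun hB _
      _ = TensorProduct.map (S.toCoeffTowerSetting.rqIterH1 i n d).toIntLinearMap LinearMap.id
            (((S.LD (i + d)).isQuotientBy n).cohomologyMap 1 (S.kappaR κ pins (i + d) n) ⊗ₜ[ℤ]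
              (PiTensorProduct.tprod ℤ fun q : ↥n => (pins q).gbar : Gn (K := K) n)) :=
          congrArg _ (S.map_subtype_κ_eq_kappaR_tmul κ pins (i + d) hker' hlev')
      _ = S.toCoeffTowerSetting.rqIterH1 i n d
            (((S.LD (i + d)).isQuotientBy n).cohomologyMap 1 (S.kappaR κ pins (i + d) n)) ⊗ₜ[ℤ]
              (PiTensorProduct.tprod ℤ fun q : ↥n => (pins q).gbar : Gn (K := K) n) := TensorProduct.map_tmul _ _ _ _
      _ = _ := congrArg (· ⊗ₜ[ℤ] (PiTensorProduct.tprod ℤ fun q : ↥n => (pins q).gbar : Gn (K := K) n))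
          (hsq (S.kappaR κ pins (i + d) n))
  exact S.eq_kappaR_of_tmul_eq κ pins i hker hlev h2

/-- **`H¹(redLE_{i ≤ k})(κ k n) = κ i n` for `n ∈ 𝓝(𝓛^{(2k-1)})`** (Howard: «`κ^{(i)}_n` is the reduction of
`κ^{(k)}_n`»). [cite: Howard2004HeegnerKolyvagin, Def. 1.2.3 and Lemma 1.6.4 proof (arXiv p. 7 L1–12, p. 11 L85 – p. 12 L1)] -/
theorem redLEH1_kappaR (S : DVRSetting p K R N Rk Nbar Nq) (hy : S.SatisfiesH) (κ : S.KolyvaginSystem)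
    (pins : ∀ v : HeightOneSpectrum (𝓞 K), TamePin v) {i k : ℕ} (h : i ≤ k) {n : Finset (HeightOneSpectrum (𝓞 K))}
    (hn : ↑n ⊆ S.enginePrimes k) :
    S.redLEH1 h (S.kappaR κ pins k n) = S.kappaR κ pins i n := by
  obtain ⟨d, rfl⟩ := Nat.exists_eq_add_of_le h
  rw [S.redLEH1_eq_redIterH1 i d h]
  exact S.redIterH1_kappaR hy κ pins i d hn

/-- **The engine's `hred`, GUARDED**: `red k i n (κ k n) = κ i n` for `i ≤ k` and `n ∈ 𝓝(𝓛^{(2k-1)})`.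
(Unguarded it is false in general: off the branch `ker π^{(k)}_n = 0`, which depends on `k`, `kappaR` is `0`.)
[cite: Howard2004HeegnerKolyvagin, Def. 1.2.3 and Lemma 1.6.4 proof (arXiv p. 7 L1–12, p. 11 L85 – p. 12 L1)] -/
theorem redSel_kappaSel (S : DVRSetting p K R N Rk Nbar Nq) (hy : S.SatisfiesH) (κ : S.KolyvaginSystem)
    (pins : ∀ v : HeightOneSpectrum (𝓞 K), TamePin v) {k i : ℕ} (h : i ≤ k)
    {n : Finset (HeightOneSpectrum (𝓞 K))} (hn : ↑n ⊆ S.enginePrimes k) :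
    letI := galoisCohomology.moduleH1 (S.T.ρ k) (S.T.hlin k)
    letI := galoisCohomology.moduleH1 (S.T.ρ i) (S.T.hlin i)
    S.redSel hy k i n (S.kappaSel hy κ pins k n) = S.kappaSel hy κ pins i n := by
  letI := galoisCohomology.moduleH1 (S.T.ρ k) (S.T.hlin k)
  letI := galoisCohomology.moduleH1 (S.T.ρ i) (S.T.hlin i)
  refine Subtype.ext ?_
  rw [S.coe_redSel_apply hy h n, coe_kappaSel, coe_kappaSel]
  exact S.redLEH1_kappaR hy κ pins h hn

/-- The same for ANY family `κE k n : H k n` whose underlying classes are the `kappaR` (so that a consumer may use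
its own letter for `κ`). [cite: Howard2004HeegnerKolyvagin, Lemma 1.6.4 proof (arXiv p. 11 L85 – p. 12 L1)] -/
theorem redSel_apply_eq_of_coe_eq_kappaR (S : DVRSetting p K R N Rk Nbar Nq) (hy : S.SatisfiesH)
    (κ : S.KolyvaginSystem) (pins : ∀ v : HeightOneSpectrum (𝓞 K), TamePin v)
    (κE : ∀ (k : ℕ) (n : Finset (HeightOneSpectrum (𝓞 K))), ↥(S.selmerModuleAt hy k n))
    (hκE : ∀ k n, (κE k n : galoisCohomology (S.T.ρ k) 1) = S.kappaR κ pins k n) {k i : ℕ} (h : i ≤ k)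
    {n : Finset (HeightOneSpectrum (𝓞 K))} (hn : ↑n ⊆ S.enginePrimes k) :
    letI := galoisCohomology.moduleH1 (S.T.ρ k) (S.T.hlin k)
    letI := galoisCohomology.moduleH1 (S.T.ρ i) (S.T.hlin i)
    S.redSel hy k i n (κE k n) = κE i n := by
  letI := galoisCohomology.moduleH1 (S.T.ρ k) (S.T.hlin k)
  letI := galoisCohomology.moduleH1 (S.T.ρ i) (S.T.hlin i)
  have hk : κE k n = S.kappaSel hy κ pins k n := Subtype.ext (hκE k n)
  have hi : κE i n = S.kappaSel hy κ pins i n := Subtype.ext (hκE i n)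
  rw [hk, hi]
  exact S.redSel_kappaSel hy κ pins h hn

/-- **`hred` in the engine's binder shape** (for `P := S.enginePrimes`, `κ := S.kappaSel hy κ pins`,
`red := S.redSel hy`): `∀ k i n, i ≤ k → ↑n ⊆ P k → red k i n (κ k n) = κ i n`.
[cite: Howard2004HeegnerKolyvagin, Lemma 1.6.4 proof (arXiv p. 11 L85 – p. 12 L1)] -/
theorem hred_kappaSel (S : DVRSetting p K R N Rk Nbar Nq) (hy : S.SatisfiesH) (κ : S.KolyvaginSystem)
    (pins : ∀ v : HeightOneSpectrum (𝓞 K), TamePin v) :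
    letI := fun k => galoisCohomology.moduleH1 (S.T.ρ k) (S.T.hlin k)
    ∀ (k i : ℕ) (n : Finset (HeightOneSpectrum (𝓞 K))), i ≤ k → ↑n ⊆ S.enginePrimes k →
      S.redSel hy k i n (S.kappaSel hy κ pins k n) = S.kappaSel hy κ pins i n :=
  fun _ _ _ h hn => S.redSel_kappaSel hy κ pins h hn

end DVRSetting

end Literature.NumberTheory.GaloisCohomology.Howard2004

end
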